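import Literature.MathematicalPhysics.QuantumFieldTheory.TorusChartCombGauge
import Mathlib.Topology.Algebra.InfiniteSum.Basic
import HarnessLib

/-!
# Re-indexing vortex-sector sums on a charted torus by (curl, winding)

`TorusChartCombGauge.lean` labels the cochains vanishing on the comb (the index set of the regrouped sum over
integer bond fields in the Villain / Fröhlich–Spencer unfolding) by the pair (curl, winding vector):
`TorusChart.sectorEquiv : combVanishing ≃+ curlImage × (Fin d → A)`, inverse `TorusChart.sectorRep`, and
`TorusChart.combRep_eq_combRep_iff`.  This file identifies the CURRIED form of the index subtype (the form
in which such sums are written) with `combVanishing` and transports unconditional sums along these bijections: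

* `TorusChart.combVanishingCurriedEquiv` — `{ρ // ∀ x μ, (∀ ν > μ, x_ν = 0) → x_μ + 1 < N_μ → ρ x μ = 0} ≃ combVanishing`;
* `TorusChart.hasSum_comb_iff_hasSum_sector` — a family indexed by the comb-vanishing cochains (curried
  subtype) sums to `s` iff `(q, w) ↦ f (sectorRep q w)` does;
* `TorusChart.hasSum_combVanishing_iff_hasSum_sector`, `TorusChart.summable_comb_iff_summable_sector`,
  `TorusChart.tsum_comb_eq_tsum_sector` — the uncurried form, summability, and the identity of `tsum`s.

This is the organisation "sum over vortex currents `q`, then over global holonomies `w`" of the sector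
series. Everything is proved; no named fact is introduced.

## References

* J. Fröhlich, T. Spencer, Comm. Math. Phys. 81 (1981) 527–602, §3. [folklore form]
-/

namespace Literature.MathematicalPhysics.QuantumFieldTheory

namespace TorusChart

variable {Λ : Type*} [AddCommGroup Λ] {d : ℕ} (F : TorusChart Λ d)
variable {A : Type*} [AddCommGroup A]

/-! ## The curried comb condition

Sums over tree-gauge integer bond fields are usually written over the subtype of cochains with the comb
condition CURRIED (`∀ x μ, (coordinates beyond μ vanish) → (no wrap) → ρ x μ = 0`); the following identifies
that index type with `combVanishing`. -/

/-- The comb-vanishing cochains with the comb condition written in curried form, as a subtype equivalent to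
`combVanishing` (same carrier). [folklore] -/
def combVanishingCurriedEquiv :
    {ρ : Λ → Fin d → A // ∀ (x : Λ) (μ : Fin d), (∀ ν : Fin d, μ < ν → F.cval ν x = 0) →
        F.cval μ x + 1 < F.period μ → ρ x μ = 0} ≃ F.combVanishing (A := A) :=
  Equiv.subtypeEquivRight fun ρ => by
    simp only [mem_combVanishing_iff, IsCombEdge, and_imp]

/-- `combVanishingCurriedEquiv` does not change the cochain. [folklore] -/
@[simp] theorem coe_combVanishingCurriedEquiv
    (ρ : {ρ : Λ → Fin d → A // ∀ (x : Λ) (μ : Fin d), (∀ ν : Fin d, μ < ν → F.cval ν x = 0) →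
        F.cval μ x + 1 < F.period μ → ρ x μ = 0}) :
    ((F.combVanishingCurriedEquiv (A := A) ρ : F.combVanishing (A := A)) : Λ → Fin d → A) = ρ.1 :=
  rfl

/-- The inverse of `combVanishingCurriedEquiv` does not change the cochain. [folklore] -/
@[simp] theorem combVanishingCurriedEquiv_symm_apply_val (ρ : F.combVanishing (A := A)) :
    ((F.combVanishingCurriedEquiv (A := A)).symm ρ).1 = (ρ : Λ → Fin d → A) :=
  rfl

/-! ## Transport of sums -/

/-- **Re-indexing a sector sum by (curl, winding)**: a family indexed by the comb-vanishing cochains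
(curried form) sums to `s` iff the family `(q, w) ↦ f (sectorRep q w)` indexed by
(curls) × (winding vectors) does. [folklore] -/
theorem hasSum_comb_iff_hasSum_sector {M : Type*} [AddCommMonoid M] [TopologicalSpace M]
    (f : (Λ → Fin d → A) → M) (s : M) :
    HasSum (fun ρ : {ρ : Λ → Fin d → A // ∀ (x : Λ) (μ : Fin d), (∀ ν : Fin d, μ < ν → F.cval ν x = 0) →
        F.cval μ x + 1 < F.period μ → ρ x μ = 0} => f ρ.1) s ↔
      HasSum (fun p : F.curlImage (A := A) × (Fin d → A) => f (F.sectorRep p.1 p.2)) s := by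
  rw [← Equiv.hasSum_iff (F.combVanishingCurriedEquiv (A := A)).symm,
    ← Equiv.hasSum_iff (F.sectorEquiv (A := A)).symm.toEquiv]
  exact Iff.rfl

/-- **Re-indexing a sector sum by (curl, winding)**, uncurried form: a family indexed by `combVanishing`
sums to `s` iff `(q, w) ↦ f (sectorRep q w)` does. [folklore] -/
theorem hasSum_combVanishing_iff_hasSum_sector {M : Type*} [AddCommMonoid M] [TopologicalSpace M]
    (f : (Λ → Fin d → A) → M) (s : M) :
    HasSum (fun ρ : F.combVanishing (A := A) => f ρ) s ↔
      HasSum (fun p : F.curlImage (A := A) × (Fin d → A) => f (F.sectorRep p.1 p.2)) s := by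
  rw [← Equiv.hasSum_iff (F.sectorEquiv (A := A)).symm.toEquiv]
  exact Iff.rfl

/-- Summability is preserved by the re-indexing. [folklore] -/
theorem summable_comb_iff_summable_sector {M : Type*} [AddCommMonoid M] [TopologicalSpace M]
    (f : (Λ → Fin d → A) → M) :
    Summable (fun ρ : {ρ : Λ → Fin d → A // ∀ (x : Λ) (μ : Fin d), (∀ ν : Fin d, μ < ν → F.cval ν x = 0) →
        F.cval μ x + 1 < F.period μ → ρ x μ = 0} => f ρ.1) ↔
      Summable (fun p : F.curlImage (A := A) × (Fin d → A) => f (F.sectorRep p.1 p.2)) :=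
  ⟨fun ⟨s, hs⟩ => ⟨s, (F.hasSum_comb_iff_hasSum_sector f s).1 hs⟩,
    fun ⟨s, hs⟩ => ⟨s, (F.hasSum_comb_iff_hasSum_sector f s).2 hs⟩⟩

/-- **Re-indexing a sector series by (curl, winding)**, `tsum` form. [folklore] -/
theorem tsum_comb_eq_tsum_sector {M : Type*} [AddCommMonoid M] [TopologicalSpace M] [T2Space M]
    (f : (Λ → Fin d → A) → M) :
    ∑' ρ : {ρ : Λ → Fin d → A // ∀ (x : Λ) (μ : Fin d), (∀ ν : Fin d, μ < ν → F.cval ν x = 0) →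
        F.cval μ x + 1 < F.period μ → ρ x μ = 0}, f ρ.1 =
      ∑' p : F.curlImage (A := A) × (Fin d → A), f (F.sectorRep p.1 p.2) :=
  tsum_eq_tsum_of_hasSum_iff_hasSum (F.hasSum_comb_iff_hasSum_sector f _)

end TorusChart

end Literature.MathematicalPhysics.QuantumFieldTheory
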